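import Mathlib.FieldTheory.PrimitiveElement
import Mathlib.FieldTheory.Galois.Basic
import Literature.NumberTheory.DiophantineGeometry.FunctionFieldConstantExtension
import HarnessLib

/-!
# Counting the lifts of a Frobenius to a Galois extension (Stichtenoth Lemma 3.6.2 + Lemma 5.2.7)

Sibling **proof file** (theorems only; no definitions, no named facts) in the chain of files
discharging the named fact `hasseWeil` of `FunctionFieldZeta` (**Stichtenoth Thm. 5.2.1**, Bombieri's
proof): the group-theoretic count entering the lower bound (5.24). In Stichtenoth, *Algebraic
Function Fields and Codes*, 2nd ed. (GTM 254), §5.2, this is Lemma 5.2.7 (in `G' = ⟨σ⟩ × G` there are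
exactly `e` cyclic subgroups `U ⊆ H` of order `n` with `U ∩ G = 1`) together with Prop. 5.2.8 (a)
(`[E' : E_i] = n`, i.e. `𝔽_q` is the full constant field of `E_i`); in Bombieri's twisted
formulation, which the sibling files use (`FunctionFieldStepanovProofs`,
`FunctionFieldHilbertRamification`), the statement needed is:

* `finrank_mul_natCard_algEquiv_restrict_eq`: let `k` be a finite field, integrally closed in `L`
  (the full constant field of the function field `L`), `Ω/L` finite Galois, and `K' ⊇ k` a finite
  field inside `Ω`. Then for every `k`-algebra map `φ : K' → K'`,
  `[K' : k] · #{θ ∈ Gal(Ω/L) ; θ|_{K'} = φ} = [Ω : L]`.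

Proof: `K' = k(β)`; the minimal polynomial of `β` over `k` stays irreducible over `L`
(**Lemma 3.6.2**, the tree's `irreducible_map_of_irreducible`), so `[L(β) : L] = [K' : k]`; the map
`β ↦ φ(β)` extends from `L(β)` to the normal extension `Ω` (Mathlib `AlgHom.liftNormal`), giving one
`θ₀` with `θ₀|_{K'} = φ`, and `θ ↦ θ₀⁻¹θ` is a bijection onto `Gal(Ω/L(β))`, of order `[Ω : L(β)]`.

## References

* H. Stichtenoth, *Algebraic Function Fields and Codes*, 2nd ed., GTM 254, Springer 2009,
  Lemma 3.6.2, Lemma 5.2.7, Prop. 5.2.8 (a). [Stichtenoth2009]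
* E. Bombieri, *Counting points on curves over finite fields (d'après S. A. Stepanov)*,
  Sém. Bourbaki 430 (1973).
-/

noncomputable section

open scoped Classical Polynomial IntermediateField

namespace Literature.NumberTheory.DiophantineGeometry.AlgFunctionField

open Polynomial IntermediateField

section Fibre

variable {k : Type*} [Field k] [Finite k] {L : Type*} [Field L] [Algebra k L]
variable {Ω : Type*} [Field Ω] [Algebra L Ω] [Algebra k Ω] [IsScalarTower k L Ω]
variable {K' : Type*} [Field K'] [Finite K'] [Algebra k K'] [Algebra K' Ω] [IsScalarTower k K' Ω]

omit [Finite k] [Finite K'] in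
/-- An `L`-algebra map of `Ω` acts on the constants `K' = k(β)` as `ψ` as soon as it does so on the
generator `β`. [folklore] -/
theorem forall_apply_algebraMap_eq_iff_gen {β : K'} (hβ : k⟮β⟯ = ⊤) (hβint : IsIntegral k β)
    (θ : Ω →ₐ[L] Ω) (ψ : K' →ₐ[k] K') :
    (∀ c : K', θ (algebraMap K' Ω c) = algebraMap K' Ω (ψ c)) ↔
      θ (algebraMap K' Ω β) = algebraMap K' Ω (ψ β) := by
  refine ⟨fun h => h β, fun h c => ?_⟩
  have hc : c ∈ Algebra.adjoin k {β} := by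
    rw [← IntermediateField.adjoin_simple_toSubalgebra_of_isAlgebraic hβint.isAlgebraic, hβ]
    exact IntermediateField.mem_top
  rw [Algebra.adjoin_singleton_eq_range_aeval] at hc
  obtain ⟨p, rfl⟩ := hc
  change θ (algebraMap K' Ω (aeval β p)) = algebraMap K' Ω (ψ (aeval β p))
  rw [← Polynomial.aeval_algHom_apply ψ β p, ← Polynomial.aeval_algebraMap_apply Ω β p,
    ← Polynomial.aeval_algebraMap_apply Ω (ψ β) p,
    show θ (aeval (algebraMap K' Ω β) p) = (θ.restrictScalars k) (aeval (algebraMap K' Ω β) p) from rfl,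
    ← Polynomial.aeval_algHom_apply (θ.restrictScalars k) (algebraMap K' Ω β) p,
    AlgHom.coe_restrictScalars', h]

omit [Finite k] [IsScalarTower k L Ω] [Finite K'] [Algebra k K'] [IsScalarTower k K' Ω] [Algebra k Ω]
  [Algebra k L] in
/-- An `L`-automorphism fixes `L(β')` pointwise iff it fixes `β'`. [folklore] -/
theorem mem_fixingSubgroup_adjoin_simple_iff {β' : Ω} (hβ' : IsIntegral L β') (θ : Ω ≃ₐ[L] Ω) :
    θ ∈ (L⟮β'⟯).fixingSubgroup ↔ θ β' = β' := by
  rw [IntermediateField.mem_fixingSubgroup_iff]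
  refine ⟨fun h => h β' (IntermediateField.mem_adjoin_simple_self L β'), fun h x hx => ?_⟩
  have hx' : x ∈ Algebra.adjoin L {β'} := by
    rwa [← IntermediateField.adjoin_simple_toSubalgebra_of_isAlgebraic hβ'.isAlgebraic]
  rw [Algebra.adjoin_singleton_eq_range_aeval] at hx'
  obtain ⟨p, rfl⟩ := hx'
  change θ (aeval β' p) = aeval β' p
  rw [← Polynomial.aeval_algHom_apply θ β' p, h]

/-- **Counting the lifts of a Frobenius** (the count behind Stichtenoth Lemma 5.2.7 /
Prop. 5.2.8 (a): `E' = E_i 𝔽_{q^n}`, `[E' : E_i] = n`). Let `k` be a finite field which is the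
full constant field of `L` (`k` integrally closed in `L`), `Ω/L` a finite Galois extension and
`K' ⊇ k` a finite field inside `Ω`. Then for every `k`-algebra map `φ` of `K'`, exactly
`[Ω : L]/[K' : k]` automorphisms `θ ∈ Gal(Ω/L)` act on `K'` as `φ`:
`[K' : k] · #{θ ; θ|_{K'} = φ} = [Ω : L]`. Proof: with `K' = k(β)`, the minimal polynomial of
`β` over `k` stays irreducible over `L` (Lemma 3.6.2, `irreducible_map_of_irreducible`), so
`[L(β) : L] = [K' : k]`; some `θ₀` acts as `φ` (extend `β ↦ φ(β)` from `L(β)` to the normal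
extension `Ω`, Mathlib `AlgHom.liftNormal`), and `θ ↦ θ₀⁻¹θ` identifies the `θ` in question with
`Gal(Ω/L(β))`, of order `[Ω : L(β)]`. [cite: Stichtenoth2009, Lemma 3.6.2 and Lemma 5.2.7] -/
theorem finrank_mul_natCard_algEquiv_restrict_eq [IsIntegrallyClosedIn k L] [FiniteDimensional L Ω]
    [IsGalois L Ω] (φ : K' →ₐ[k] K') :
    Module.finrank k K' *
        Nat.card {θ : Ω ≃ₐ[L] Ω // ∀ c : K', θ (algebraMap K' Ω c) = algebraMap K' Ω (φ c)} =
      Nat.card (Ω ≃ₐ[L] Ω) := by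
  haveI := Fintype.ofFinite k
  haveI : FiniteDimensional k K' := inferInstance
  haveI : Algebra.IsSeparable k K' := inferInstance
  -- a primitive element `β` of `K'/k` and its minimal polynomial
  obtain ⟨β, hβ⟩ := Field.exists_primitive_element k K'
  have hβint : IsIntegral k β := Algebra.IsIntegral.isIntegral β
  set μ : k[X] := minpoly k β with hμ
  have hμirr : Irreducible μ := minpoly.irreducible hβint
  set β' : Ω := algebraMap K' Ω β with hβ'
  have hβ'k : IsIntegral k β' := hβint.map (IsScalarTower.toAlgHom k K' Ω)
  have hβ'int : IsIntegral L β' := hβ'k.tower_top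
  -- the minimal polynomial over `L` is still `μ` (Lemma 3.6.2)
  have haevalμ : ∀ ψ : K' →ₐ[k] K', aeval (algebraMap K' Ω (ψ β)) (μ.map (algebraMap k L)) = 0 := by
    intro ψ
    rw [aeval_map_algebraMap, aeval_algebraMap_apply, aeval_algHom_apply, hμ, minpoly.aeval, map_zero,
      map_zero]
  have hmin : minpoly L β' = μ.map (algebraMap k L) := by
    refine (minpoly.eq_of_irreducible_of_monic (irreducible_map_of_irreducible hμirr) ?_
      ((minpoly.monic hβint).map _)).symm
    have h := haevalμ (AlgHom.id k K')
    rwa [AlgHom.id_apply] at h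
  have hdegK' : Module.finrank k K' = μ.natDegree := by
    rw [hμ, ← IntermediateField.adjoin.finrank hβint, hβ]
    exact (IntermediateField.topEquiv (F := k) (E := K')).toLinearEquiv.finrank_eq.symm
  -- the intermediate field `M = L(β')`, of degree `[K' : k]`
  set M : IntermediateField L Ω := L⟮β'⟯ with hM
  have hMdeg : Module.finrank L M = Module.finrank k K' := by
    rw [hM, IntermediateField.adjoin.finrank hβ'int, hmin, natDegree_map, hdegK']
  -- its fixing subgroup has `[Ω : M]` elements
  have hH : Nat.card M.fixingSubgroup = Module.finrank M Ω := by
    rw [Nat.card_congr (IntermediateField.fixingSubgroupEquiv M).toEquiv]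
    exact IsGalois.card_aut_eq_finrank M Ω
  -- an automorphism `θ₀` acting as `φ` on `K'`
  have hroot : algebraMap K' Ω (φ β) ∈ (minpoly L β').aroots Ω := by
    rw [mem_aroots, hmin]
    exact ⟨(Polynomial.map_ne_zero_iff (algebraMap k L).injective).2 hμirr.ne_zero, haevalμ φ⟩
  set η : L⟮β'⟯ →ₐ[L] Ω := (algHomAdjoinIntegralEquiv L hβ'int).symm ⟨_, hroot⟩ with hη
  have hηgen : η (AdjoinSimple.gen L β') = algebraMap K' Ω (φ β) :=
    algHomAdjoinIntegralEquiv_symm_apply_gen L hβ'int ⟨_, hroot⟩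
  set θ₀ : Ω ≃ₐ[L] Ω := AlgEquiv.ofBijective (η.liftNormal Ω) (AlgHom.normal_bijective L Ω Ω _)
    with hθ₀
  have hθ₀β : θ₀ β' = algebraMap K' Ω (φ β) := by
    have h := AlgHom.liftNormal_commutes η Ω (AdjoinSimple.gen L β')
    rw [hηgen] at h
    exact h
  -- the `θ` acting as `φ` correspond to the fixing subgroup via `θ ↦ θ₀⁻¹ θ`
  have hS : Nat.card {θ : Ω ≃ₐ[L] Ω // ∀ c : K', θ (algebraMap K' Ω c) = algebraMap K' Ω (φ c)} =
      Nat.card M.fixingSubgroup := by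
    refine Nat.card_congr ?_
    refine
      { toFun := fun θ => ⟨θ₀⁻¹ * θ.1, ?_⟩
        invFun := fun θ => ⟨θ₀ * θ.1, ?_⟩
        left_inv := fun θ => Subtype.ext (by simp)
        right_inv := fun θ => Subtype.ext (by simp) }
    · have h2 : θ.1 β' = algebraMap K' Ω (φ β) := by rw [hβ']; exact θ.2 β
      rw [hM, mem_fixingSubgroup_adjoin_simple_iff hβ'int, AlgEquiv.mul_apply, h2]
      change θ₀.symm (algebraMap K' Ω (φ β)) = β'
      rw [← hθ₀β, AlgEquiv.symm_apply_apply]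
    · have hθ : θ.1 β' = β' := (mem_fixingSubgroup_adjoin_simple_iff hβ'int θ.1).1 (hM ▸ θ.2)
      refine (forall_apply_algebraMap_eq_iff_gen hβ hβint ((θ₀ * θ.1 : Ω ≃ₐ[L] Ω) : Ω →ₐ[L] Ω) φ).2 ?_
      change θ₀ (θ.1 β') = _
      rw [hθ, hθ₀β]
  -- count
  rw [hS, hH, ← hMdeg, Module.finrank_mul_finrank, IsGalois.card_aut_eq_finrank]

end Fibre

end Literature.NumberTheory.DiophantineGeometry.AlgFunctionField
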